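import Mathlib
import Summits.ValiantsHypothesis.ValiantsHypothesis.Theorems.LacunarySymmetroidMatrixDescartesDoorA26WallBubblingBubblingDefs

/-!
# Real exponential sums: twisted Rolle and the robust term count (B1–B3) — turnkey helper, val-idea-15

Module of the BUBBLING REDUCTION for obligation (B) `Stmt.stub_bubbling` of the line `Cruxes/DoorA26/Lines/wall_bubbling.lean`
(stmt-ValiantsHypothesis-19979, `Theses.LacunarySymmetroid.DoorA26`).  Contents: `expSum_sub_classSum_eventually_small` (B1), `zeros_le_distinct_exponents_sub_one` (B2, iterated twisted Rolle — no multiplicities),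
`robust_term_count'` (B3: along coefficient/exponent sequences converging to a limit with an active class, the number of zeros in a
fixed window is eventually `≤ |Λ| − 1`). [this work]

HONEST FRAMING / PROVENANCE.  Turnkey port of ideator val-idea-15 g1 (crux workfile `Cruxes/DoorA26/Lines/wall_bubbling_Assembly.lean`, commit d4cb61350496, ZERO `sorry`; split into ≤ 400-line modules, one
namespace `…WallBubbling.Bubbling`, single copies of the definitions), filed by prover seat val-port-4 g1 (val-lit port pool; desk g12 RULING #266 (b), director R166/R168) with `--supports stmt-ValiantsHypothesis-19979 --as helper`.
Mathlib-only mathematics (elementary real analysis, linear algebra, finite combinatorics); nothing here bears on `DoorA26` (OPEN; obligations (W), (M), (R) of the line remain),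
on `MatrixDescartes` (stmt-ValiantsHypothesis-18050) or on `VP ≠ VNP`.
-/

-- `Summit.ValiantsHypothesis.ValiantsHypothesis.…` repeats a component by the D-0017 layout
-- (single-conjunct summit), which the `dupNamespace` linter flags; the name is mandated.
set_option linter.dupNamespace false

namespace Summit.ValiantsHypothesis.ValiantsHypothesis.Theorems.LacunarySymmetroidMatrixDescartes.WallBubbling.Bubbling

/-! # Part I — real exponential sums: twisted Rolle and the robust term count (B1–B3; workfile `Lines/wall_bubbling_TwistedRolleExp.lean`) -/


open Finset Filter Topology

variable {ι : Type*} [Fintype ι]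



/-! ## B2 — twist algebra -/

/-- Multiplying by `exp (−v t)` shifts every exponent by `−v`. [folklore] -/
theorem expSum_twist (a x : ι → ℝ) (v t : ℝ) :
    Real.exp (-(v * t)) * expSum a x t = expSum a (fun i => x i - v) t := by
  unfold expSum
  rw [Finset.mul_sum]
  refine Finset.sum_congr rfl fun i _ => ?_
  rw [sub_mul, Real.exp_sub, Real.exp_neg]
  ring

/-- The derivative of an exponential sum is the exponential sum with coefficients `a i · x i`. [folklore] -/
theorem hasDerivAt_expSum (a x : ι → ℝ) (t : ℝ) :
    HasDerivAt (expSum a x) (expSum (fun i => a i * x i) x t) t := by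
  have h : HasDerivAt (fun s => ∑ i, a i * Real.exp (x i * s))
      (∑ i, a i * (Real.exp (x i * t) * (x i * 1))) t := by
    apply HasDerivAt.fun_sum
    intro i _
    exact (((hasDerivAt_id' t).const_mul (x i)).exp).const_mul (a i)
  have hfun : expSum a x = fun s => ∑ i, a i * Real.exp (x i * s) := rfl
  rw [hfun]
  convert h using 1
  unfold expSum
  refine Finset.sum_congr rfl fun i _ => ?_
  ring

/-- Grouping an exponential sum by exponent classes. [folklore] -/
theorem expSum_eq_sum_classes [DecidableEq ℝ] (a x : ι → ℝ) (t : ℝ) :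
    expSum a x t = ∑ w ∈ Finset.univ.image x, Real.exp (w * t) * classSum a x w := by
  unfold expSum classSum
  symm
  rw [← Finset.sum_fiberwise_of_maps_to (s := Finset.univ) (t := Finset.univ.image x) (g := x)
    (fun i hi => Finset.mem_image_of_mem x hi) (fun i => a i * Real.exp (x i * t))]
  refine Finset.sum_congr rfl fun w _ => ?_
  rw [Finset.sum_filter, Finset.mul_sum]
  refine Finset.sum_congr rfl fun i _ => ?_
  by_cases h : x i = w
  · rw [if_pos h, if_pos h, h]
    ring
  · rw [if_neg h, if_neg h, mul_zero]

/-- With a single active class `w₀` the limit sum is the monomial `exp (w₀ t) · classSum w₀`. [folklore] -/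
theorem expSum_eq_of_single_class (a x : ι → ℝ) (w₀ : ℝ)
    (hA : ∀ w, w ≠ w₀ → classSum a x w = 0) (t : ℝ) :
    expSum a x t = Real.exp (w₀ * t) * classSum a x w₀ := by
  classical
  rw [expSum_eq_sum_classes]
  refine Finset.sum_eq_single w₀ (fun w _ hw => ?_) (fun hw₀ => ?_)
  · rw [hA w hw, mul_zero]
  · have : classSum a x w₀ = 0 := by
      unfold classSum
      refine Finset.sum_eq_zero fun i _ => ?_
      rw [if_neg]
      intro h
      exact hw₀ (h ▸ Finset.mem_image_of_mem x (Finset.mem_univ i))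
    rw [this, mul_zero]

/-- The class sums of the twisted and differentiated data: `classSum' u = u · classSum (u + v)`. [folklore] -/
theorem classSum_twist (a x : ι → ℝ) (v u : ℝ) :
    classSum (fun i => a i * (x i - v)) (fun i => x i - v) u = u * classSum a x (u + v) := by
  unfold classSum
  rw [Finset.mul_sum]
  refine Finset.sum_congr rfl fun i _ => ?_
  dsimp only
  by_cases h : x i - v = u
  · have h' : x i = u + v := by linarith
    rw [if_pos h, if_pos h', h]
    ring
  · have h' : ¬ x i = u + v := fun h'' => h (by linarith)
    rw [if_neg h, if_neg h', mul_zero]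

/-! ## B1 — Rolle count (distinct zeros only) -/

/-- Between `m + 1` strictly increasing zeros of `φ` lie `m` strictly increasing zeros of `φ'`. [folklore: Rolle] -/
theorem rolle_count_fin {φ φ' : ℝ → ℝ} (hφ : ∀ t, HasDerivAt φ (φ' t) t) {m : ℕ}
    (z : Fin (m + 1) → ℝ) (hz : StrictMono z) (h0 : ∀ i, φ (z i) = 0) :
    ∃ c : Fin m → ℝ, StrictMono c ∧ (∀ k, z k.castSucc < c k ∧ c k < z k.succ) ∧ ∀ k, φ' (c k) = 0 := by
  have hrolle : ∀ k : Fin m, ∃ c, z k.castSucc < c ∧ c < z k.succ ∧ φ' c = 0 := by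
    intro k
    have hlt : z k.castSucc < z k.succ := hz Fin.castSucc_lt_succ
    obtain ⟨c, hc, hc0⟩ := exists_hasDerivAt_eq_zero hlt
      (fun t _ => (hφ t).continuousAt.continuousWithinAt)
      (by rw [h0, h0]) (fun t _ => hφ t)
    exact ⟨c, hc.1, hc.2, hc0⟩
  choose c hc1 hc2 hc0 using hrolle
  refine ⟨c, ?_, fun k => ⟨hc1 k, hc2 k⟩, hc0⟩
  intro k k' hkk'
  have hle : z k.succ ≤ z k'.castSucc := by
    apply hz.monotone
    rw [Fin.le_def]
    simp only [Fin.val_succ, Fin.val_castSucc]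
    exact hkk'
  calc c k < z k.succ := hc2 k
    _ ≤ z k'.castSucc := hle
    _ < c k' := hc1 k'

/-- **B1.** If `φ` vanishes on a finite set `Z ⊆ [A, B]` then `φ'` vanishes on a finite set `Z' ⊆ [A, B]` with
`Z.card ≤ Z'.card + 1` — distinct zeros only, no multiplicities. [folklore: Rolle] -/
theorem rolle_count {φ φ' : ℝ → ℝ} (hφ : ∀ t, HasDerivAt φ (φ' t) t) (A B : ℝ) (Z : Finset ℝ)
    (hZ : ∀ z ∈ Z, z ∈ Set.Icc A B ∧ φ z = 0) :
    ∃ Z' : Finset ℝ, Z.card ≤ Z'.card + 1 ∧ ∀ z ∈ Z', z ∈ Set.Icc A B ∧ φ' z = 0 := by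
  classical
  rcases Nat.lt_or_ge Z.card 1 with hsmall | hbig
  · exact ⟨∅, by simp; omega, by simp⟩
  obtain ⟨m, hm⟩ : ∃ m, Z.card = m + 1 := ⟨Z.card - 1, by omega⟩
  let e : Fin (m + 1) ↪o ℝ := Z.orderEmbOfFin hm
  have he_mem : ∀ i, e i ∈ Z := fun i => Z.orderEmbOfFin_mem hm i
  obtain ⟨c, hcmono, hcbetween, hc0⟩ := rolle_count_fin hφ e e.strictMono (fun i => (hZ _ (he_mem i)).2)
  refine ⟨Finset.univ.image c, ?_, ?_⟩
  · rw [Finset.card_image_of_injective _ hcmono.injective, Finset.card_univ, Fintype.card_fin]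
    omega
  · intro w hw
    obtain ⟨k, _, rfl⟩ := Finset.mem_image.mp hw
    refine ⟨⟨?_, ?_⟩, hc0 k⟩
    · exact le_trans (hZ _ (he_mem _)).1.1 (hcbetween k).1.le
    · exact le_trans (hcbetween k).2.le (hZ _ (he_mem _)).1.2

/-! ## B3 — the robust term count -/

/-- Single active class ⇒ no zeros in a fixed window for all large `ν`.  Proof by sequential compactness:
a sequence of zeros `t_ν ∈ [−R, R]` would accumulate at some `t₀` where the limit sum equals
`exp (w₀ t₀) · classSum w₀ ≠ 0`. [folklore] -/
theorem eventually_no_zero (a x : ℕ → ι → ℝ) (a₀ x₀ : ι → ℝ) (w₀ : ℝ)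
    (ha : ∀ i, Tendsto (fun ν => a ν i) atTop (𝓝 (a₀ i)))
    (hx : ∀ i, Tendsto (fun ν => x ν i) atTop (𝓝 (x₀ i)))
    (hw₀ : classSum a₀ x₀ w₀ ≠ 0) (hA : ∀ w, w ≠ w₀ → classSum a₀ x₀ w = 0) (R : ℝ) :
    ∀ᶠ ν in atTop, ∀ t ∈ Set.Icc (-R) R, expSum (a ν) (x ν) t ≠ 0 := by
  by_contra H
  have H' : ∃ᶠ ν in atTop, ∃ t ∈ Set.Icc (-R) R, expSum (a ν) (x ν) t = 0 := by
    rw [Filter.not_eventually] at H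
    refine H.mono fun ν h => ?_
    by_contra h'
    apply h
    intro t ht h0
    exact h' ⟨t, ht, h0⟩
  obtain ⟨φ, hφ, hφP⟩ := Filter.extraction_of_frequently_atTop H'
  choose t ht h0 using hφP
  obtain ⟨t₀, _, ψ, hψ, hlim⟩ := isCompact_Icc.tendsto_subseq ht
  have hsub : Tendsto (φ ∘ ψ) atTop atTop := (hφ.comp hψ).tendsto_atTop
  have key : Tendsto (fun n => expSum (a (φ (ψ n))) (x (φ (ψ n))) (t (ψ n))) atTop
      (𝓝 (expSum a₀ x₀ t₀)) := by
    unfold expSum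
    apply tendsto_finsetSum
    intro i _
    have h1 : Tendsto (fun n => a (φ (ψ n)) i) atTop (𝓝 (a₀ i)) := (ha i).comp hsub
    have h2 : Tendsto (fun n => x (φ (ψ n)) i) atTop (𝓝 (x₀ i)) := (hx i).comp hsub
    have h3 : Tendsto (fun n => x (φ (ψ n)) i * t (ψ n)) atTop (𝓝 (x₀ i * t₀)) := h2.mul hlim
    exact h1.mul ((Real.continuous_exp.tendsto _).comp h3)
  have hzero : (fun n => expSum (a (φ (ψ n))) (x (φ (ψ n))) (t (ψ n))) = fun _ => (0 : ℝ) :=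
    funext fun n => h0 (ψ n)
  rw [hzero] at key
  have hlim0 : expSum a₀ x₀ t₀ = 0 := (tendsto_const_nhds_iff.mp key).symm
  rw [expSum_eq_of_single_class a₀ x₀ w₀ hA t₀] at hlim0
  exact hw₀ ((mul_eq_zero.mp hlim0).resolve_left (Real.exp_pos _).ne')

/-- **B3 (robust term count).**  Let `g_ν = expSum (a ν) (x ν)` with coefficientwise and exponentwise limits
`a₀, x₀`.  If every ACTIVE limit class (`classSum a₀ x₀ w ≠ 0`) lies in a finset `V` with `V.card ≤ n + 1`, and some
class is active, then for every window `[−R, R]` and all large `ν`, every finite set of zeros of `g_ν` in the window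
has at most `n` elements.  Proof: induction on `n`; with one active class use `eventually_no_zero`; otherwise twist
at an active exponent `w₀` (`expSum_twist`), differentiate (`hasDerivAt_expSum`), count with `rolle_count`, and apply
the induction hypothesis to the twisted family, whose active classes are `{w − w₀ : w active, w ≠ w₀}`
(`classSum_twist`).  No multiplicities, no Hurwitz. [folklore: Laguerre's twisted Rolle] -/
theorem robust_term_count (n : ℕ) :
    ∀ (a x : ℕ → ι → ℝ) (a₀ x₀ : ι → ℝ) (V : Finset ℝ),
      (∀ i, Tendsto (fun ν => a ν i) atTop (𝓝 (a₀ i))) →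
      (∀ i, Tendsto (fun ν => x ν i) atTop (𝓝 (x₀ i))) →
      (∀ w, classSum a₀ x₀ w ≠ 0 → w ∈ V) → V.card ≤ n + 1 →
      (∃ w, classSum a₀ x₀ w ≠ 0) →
      ∀ R : ℝ, ∀ᶠ ν in atTop, ∀ Z : Finset ℝ,
        (∀ z ∈ Z, z ∈ Set.Icc (-R) R ∧ expSum (a ν) (x ν) z = 0) → Z.card ≤ n := by
  classical
  induction n with
  | zero =>
    intro a x a₀ x₀ V ha hx hV hcard hne R
    obtain ⟨w₀, hw₀⟩ := hne
    have hA : ∀ w, w ≠ w₀ → classSum a₀ x₀ w = 0 := by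
      intro w hw
      by_contra h
      exact hw (Finset.card_le_one.mp (by omega) w (hV w h) w₀ (hV w₀ hw₀))
    filter_upwards [eventually_no_zero a x a₀ x₀ w₀ ha hx hw₀ hA R] with ν hν Z hZ
    rw [Nat.le_zero, Finset.card_eq_zero, Finset.eq_empty_iff_forall_notMem]
    intro z hz
    exact hν z (hZ z hz).1 (hZ z hz).2
  | succ n ih =>
    intro a x a₀ x₀ V ha hx hV hcard hne R
    obtain ⟨w₀, hw₀⟩ := hne
    by_cases hA : ∀ w, w ≠ w₀ → classSum a₀ x₀ w = 0
    · filter_upwards [eventually_no_zero a x a₀ x₀ w₀ ha hx hw₀ hA R] with ν hν Z hZ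
      have : Z = ∅ := by
        rw [Finset.eq_empty_iff_forall_notMem]
        intro z hz
        exact hν z (hZ z hz).1 (hZ z hz).2
      rw [this, Finset.card_empty]
      exact Nat.zero_le _
    · -- a second active class `w₁ ≠ w₀`: twist at `w₀`
      obtain ⟨w₁, hw₁⟩ : ∃ w₁, w₁ ≠ w₀ ∧ classSum a₀ x₀ w₁ ≠ 0 := by
        by_contra h
        apply hA
        intro w hw
        by_contra h'
        exact h ⟨w, hw, h'⟩
      -- twisted data
      set a' : ℕ → ι → ℝ := fun ν i => a ν i * (x ν i - w₀) with ha'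
      set x' : ℕ → ι → ℝ := fun ν i => x ν i - w₀ with hx'
      set a₀' : ι → ℝ := fun i => a₀ i * (x₀ i - w₀) with ha₀'
      set x₀' : ι → ℝ := fun i => x₀ i - w₀ with hx₀'
      set V' : Finset ℝ := (V.erase w₀).image (fun w => w - w₀) with hV'
      have ha't : ∀ i, Tendsto (fun ν => a' ν i) atTop (𝓝 (a₀' i)) :=
        fun i => (ha i).mul ((hx i).sub_const w₀)
      have hx't : ∀ i, Tendsto (fun ν => x' ν i) atTop (𝓝 (x₀' i)) :=
        fun i => (hx i).sub_const w₀
      have hclass : ∀ u, classSum a₀' x₀' u = u * classSum a₀ x₀ (u + w₀) :=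
        fun u => classSum_twist a₀ x₀ w₀ u
      have hw₀V : w₀ ∈ V := hV w₀ hw₀
      have hV'cov : ∀ u, classSum a₀' x₀' u ≠ 0 → u ∈ V' := by
        intro u hu
        rw [hclass] at hu
        have hu0 : u ≠ 0 := by
          rintro rfl
          exact hu (zero_mul _)
        have hmem : u + w₀ ∈ V := hV _ (right_ne_zero_of_mul hu)
        rw [hV', Finset.mem_image]
        refine ⟨u + w₀, Finset.mem_erase.mpr ⟨?_, hmem⟩, by ring⟩
        intro h
        apply hu0
        linarith
      have hV'card : V'.card ≤ n + 1 := by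
        calc V'.card ≤ (V.erase w₀).card := Finset.card_image_le
          _ = V.card - 1 := Finset.card_erase_of_mem hw₀V
          _ ≤ n + 1 := by omega
      have hne' : ∃ u, classSum a₀' x₀' u ≠ 0 := by
        refine ⟨w₁ - w₀, ?_⟩
        rw [hclass, sub_add_cancel]
        exact mul_ne_zero (sub_ne_zero.mpr hw₁.1) hw₁.2
      filter_upwards [ih a' x' a₀' x₀' V' ha't hx't hV'cov hV'card hne' R] with ν hν Z hZ
      -- zeros of `g_ν` are zeros of the twisted sum, whose derivative is the twisted-differentiated sum
      have hderiv : ∀ s, HasDerivAt (expSum (a ν) (x' ν)) (expSum (a' ν) (x' ν) s) s :=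
        fun s => hasDerivAt_expSum (a ν) (x' ν) s
      have hZ' : ∀ z ∈ Z, z ∈ Set.Icc (-R) R ∧ expSum (a ν) (x' ν) z = 0 := by
        intro z hz
        refine ⟨(hZ z hz).1, ?_⟩
        have := expSum_twist (a ν) (x ν) w₀ z
        rw [(hZ z hz).2, mul_zero] at this
        exact this.symm
      obtain ⟨Z', hcardZ', hZ'0⟩ := rolle_count hderiv (-R) R Z hZ'
      have := hν Z' hZ'0
      omega

/-- **B3, counted form.**  Same hypotheses with `V` = the set of active classes itself: for all large `ν`, a finite
set of zeros of `g_ν` in `[−R, R]` has at most `V.card − 1` elements. [folklore] -/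
theorem robust_term_count' (a x : ℕ → ι → ℝ) (a₀ x₀ : ι → ℝ) (V : Finset ℝ)
    (ha : ∀ i, Tendsto (fun ν => a ν i) atTop (𝓝 (a₀ i)))
    (hx : ∀ i, Tendsto (fun ν => x ν i) atTop (𝓝 (x₀ i)))
    (hV : ∀ w, classSum a₀ x₀ w ≠ 0 → w ∈ V) (hne : ∃ w, classSum a₀ x₀ w ≠ 0) (R : ℝ) :
    ∀ᶠ ν in atTop, ∀ Z : Finset ℝ,
      (∀ z ∈ Z, z ∈ Set.Icc (-R) R ∧ expSum (a ν) (x ν) z = 0) → Z.card + 1 ≤ V.card := by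
  have hVpos : 1 ≤ V.card := by
    obtain ⟨w, hw⟩ := hne
    exact Finset.card_pos.mpr ⟨w, hV w hw⟩
  filter_upwards [robust_term_count (V.card - 1) a x a₀ x₀ V ha hx hV (by omega) hne R] with ν hν Z hZ
  have := hν Z hZ
  omega

end Summit.ValiantsHypothesis.ValiantsHypothesis.Theorems.LacunarySymmetroidMatrixDescartes.WallBubbling.Bubbling
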